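import Literature.Probability.Percolation.QuadLowestCrossingDefs
import Literature.Probability.Percolation.QuadCrossingNullFrontier
import HarnessLib

/-!
# A crossing of a chart quad is a chart crossing (Schramm–Smirnov, §1.3 and proof of Lemma 5.1)

Topic `Probability/Percolation`; proofs only, no named fact is introduced.  For the chart quads
`Q = Quad.rectQuad H a b` of `QuadCrossingNullFrontier.lean` — the rectangle `[-a, a] × [-b, b]`
read through a homeomorphism `H : ℂ ≃ₜ ℂ` of the plane, i.e. Schramm–Smirnov's perturbations `Q^q`
of a quad in the proof of Lemma 5.1 of O. Schramm, S. Smirnov, *On the scaling limits of planar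
percolation* — we prove that a crossing `K` of `Q` in the sense of §1.3 (`Quad.IsCrossing`: a
continuum of `[Q]` meeting the opposite sides `∂₀Q` and `∂₂Q`) lying in the drawn open edges
`openEdgeUnion δ ω` of bond percolation on `δℤ²` pulls back by `H⁻¹` to a witness of
`SSContinuity.ChartCrossed H (-a) a (-b) b δ ω` (`QuadLowestCrossingDefs.lean`: a continuum of the
chart rectangle `[-a, a] ×ℂ [-b, b]`, drawn by `H` into the open edges, meeting the vertical sides
`re = -a` and `re = a`):

* `rectMap_mem_reProdIm` — the chart `rectMap a b` of `[0,1]²` takes values in `[-a, a] ×ℂ [-b, b]`;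
* `re_rectMap_of_fst_eq_zero`, `re_rectMap_of_fst_eq_one` — its left / right edges `{0} × [0,1]`,
  `{1} × [0,1]` go to `re = -a`, `re = a`;
* `chartCrossed_of_isCrossing_rectQuad` — the translation itself (witness `H⁻¹ '' K`).

This is the dictionary between the two formalisations of "the quad `H([-a, a] × [-b, b])` is crossed
by an open cluster" needed when Lemma 5.1 is discharged through the one-sided continuity moves of
the proof of Lemma 6.1 (`QuadLowestCrossingProofs.lean`).

## References

* O. Schramm, S. Smirnov, *On the scaling limits of planar percolation*, Ann. Probab. 39 (2011)
  1768–1814, arXiv:1101.5820, §1.3 (quads, crossings) and proof of Lemma 5.1 (the quads `Q^q`).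
  [SchrammSmirnov2011]
-/

noncomputable section

open Set Complex
open scoped unitInterval
open Literature.Probability.LatticeModels

namespace Literature.Probability.Percolation

namespace SSContinuity

open QuadCrossing

/-- The chart `rectMap a b` of the square (`0 ≤ a, b`) takes values in the closed chart rectangle
`[-a, a] ×ℂ [-b, b]`. [folklore] -/
theorem rectMap_mem_reProdIm {a b : ℝ} (ha : 0 ≤ a) (hb : 0 ≤ b) (p : I × I) :
    Quad.rectMap a b p ∈ Icc (-a) a ×ℂ Icc (-b) b := by
  rw [mem_reProdIm, (Quad.rectMap_re_im a b p).1, (Quad.rectMap_re_im a b p).2]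
  have h1 := Quad.abs_two_mul_sub_one_le p.1
  have h2 := Quad.abs_two_mul_sub_one_le p.2
  rw [abs_le] at h1 h2
  exact ⟨⟨by nlinarith, by nlinarith⟩, ⟨by nlinarith, by nlinarith⟩⟩

/-- The left edge `{0} × [0,1]` of the square is charted onto `re = -a`. [folklore] -/
theorem re_rectMap_of_fst_eq_zero (a b : ℝ) {p : I × I} (hp : p.1 = 0) :
    (Quad.rectMap a b p).re = -a := by
  rw [(Quad.rectMap_re_im a b p).1, hp, Set.Icc.coe_zero]
  ring

/-- The right edge `{1} × [0,1]` of the square is charted onto `re = a`. [folklore] -/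
theorem re_rectMap_of_fst_eq_one (a b : ℝ) {p : I × I} (hp : p.1 = 1) :
    (Quad.rectMap a b p).re = a := by
  rw [(Quad.rectMap_re_im a b p).1, hp, Set.Icc.coe_one]
  ring

/-- **A Schramm–Smirnov crossing of the chart quad `H ∘ rectMap a b` inside the open edges is a
chart crossing.**  If `K` is a crossing of the quad `Quad.rectQuad H a b` (a continuum of
`H([-a, a] × [-b, b])` meeting the sides `∂₀ = H({-a} × [-b, b])` and `∂₂ = H({a} × [-b, b])`) and
`K ⊆ openEdgeUnion δ ω`, then `H⁻¹ '' K` witnesses `ChartCrossed H (-a) a (-b) b δ ω`: it is compact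
and connected as a continuous image, lies in `[-a, a] ×ℂ [-b, b] = H⁻¹ [Q]`, is drawn by `H` onto
`K ⊆ openEdgeUnion δ ω`, and contains the `H⁻¹`-images of the points of `K` on `∂₀`, `∂₂`, whose real
parts are `-a`, `a`. [cite: SchrammSmirnov2011, §1.3] -/
theorem chartCrossed_of_isCrossing_rectQuad {D : Set ℂ} (H : ℂ ≃ₜ ℂ) (a b : ℝ) (ha : 0 < a)
    (hb : 0 < b) (hD : ∀ p : I × I, H (Quad.rectMap a b p) ∈ D) (δ : ℝ)
    (ω : BondConfig (Site 2)) (K : Set ℂ) (hK : (Quad.rectQuad H a b ha hb hD).IsCrossing K)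
    (hKω : K ⊆ openEdgeUnion δ ω) : ChartCrossed H (-a) a (-b) b δ ω := by
  obtain ⟨hKc, hKconn, hKsub, ⟨x₀, hx₀K, hx₀s⟩, ⟨x₂, hx₂K, hx₂s⟩⟩ := hK
  refine ⟨H.symm '' K, ?_, hKc.image H.symm.continuous,
    hKconn.image _ H.symm.continuous.continuousOn, ?_, ?_, ?_⟩
  · rintro _ ⟨x, hx, rfl⟩
    obtain ⟨p, rfl⟩ := hKsub hx
    rw [Quad.rectQuad_apply, Homeomorph.symm_apply_apply]
    exact rectMap_mem_reProdIm ha.le hb.le p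
  · rintro _ ⟨x, hx, rfl⟩
    rw [Homeomorph.apply_symm_apply]
    exact hKω hx
  · obtain ⟨p, hp, rfl⟩ := hx₀s
    refine ⟨H.symm (Quad.rectQuad H a b ha hb hD p), mem_image_of_mem _ hx₀K, ?_⟩
    rw [Quad.rectQuad_apply, Homeomorph.symm_apply_apply]
    exact re_rectMap_of_fst_eq_zero a b hp
  · obtain ⟨p, hp, rfl⟩ := hx₂s
    refine ⟨H.symm (Quad.rectQuad H a b ha hb hD p), mem_image_of_mem _ hx₂K, ?_⟩
    rw [Quad.rectQuad_apply, Homeomorph.symm_apply_apply]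
    exact re_rectMap_of_fst_eq_one a b hp

end SSContinuity

end Literature.Probability.Percolation

end
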